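/-
Copyright: statement-level skeleton of a published paper (lit-balaban cell, Phase-2 proof seat p13, gen 9). No proof
claims beyond what the kernel checks below.
-/
import Literature.MathematicalPhysics.QuantumFieldTheory.BalabanImbrieJaffe1984to88.BIJ88F1Taylor290

/-!
# `BalabanImbrieJaffe1984to88.BIJ88F1Localized290` — T. Bałaban, J. Imbrie, A. Jaffe, *Effective action and cluster
properties of the abelian Higgs model*, Commun. Math. Phys. **114** (1988) 257–315 [BalabanImbrieJaffe1988]: Sect. 5.7,
p. 290 — the first display preceding (5.7.7), **with its sum over regions `X` and the printed remainder bound**: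
*"F_{1,j}(Ã̃^ζ_b) = Σ_{n=1}^{n̄} ζ^{−1}(ie_jζÃ̃^ζ_b)ⁿ/n! + Σ_X F_{1,j,b}(X), with |F_{1,j,b}(X)| ≦ e_j^{n̄+1−α}e^{−cr(e_k)|X|⁻}"* — the
localized remainder `F_{1,j,b}(X)` CONSTRUCTED from (5.7.5) and the identity and bound PROVED (file 1a of seat p13 gen 9
towards (5.7.7); 1b = `BIJ88F2Localized290` (the `F_{2,j}` display + the `ℤ^d` model instance), 2 = `BIJ88Expansion577`,
3 = `BIJ88WSplit290`).

statement-level skeleton of published theorems with citation tags; proofs where landed; nothing here is a claim about the Yang–Mills mass gap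

PDF held: `paper:balaban1988-cmp114-bij-abelian-higgs-effective-action` (journal page = PDF page + 256); pp. 287–290
[PDF 31–34] read as IMAGES (CCITT renders `pages/original-p031-x2.png` …; copies `HOME/lit-balaban-p13/pages/`).

CITATION HEADER (lean-in-tree rule).  Part of the lit-balaban TYPED SKELETON (HOME `run/shared/lean/pub/lit-balaban/`):
WHAT IS REPRODUCED = row **C2.Eq5.7.7-5.7.9** of `HOME/lit-balaban-r16/ROWS-C2-part2.md`, member *(5.7.7), the two p. 290
expansion displays* — typed so far by p02's `BIJ88F1Taylor290` as the ORDER split `F₁ = taylorF1 + remF1` (*"X-localization not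
claimed"*); here the `X`-LOCALIZATION is added.  Unit `lit-balaban-p13` (gen 9), owner r16, referee ref-5.  Built BY NAME on
r16's (5.7.5) `BIJ88Sect5StatementsPart4.wbm`/`F2`, p02's `BIJ88F1Taylor290.remF1`/`F1_zeta_split`/`F2_split`, r16's
`BIJ88Sect5StatementsPart2.PolymerSys.cardMinus`/`Ineq576`; nothing restated.

## The print (p. 289 [PDF 33] – p. 290 [PDF 34], verbatim)

p. 289: *"For example, we have in F_{1,j}(Ã̃_b) a series involving powers of (w₅A′)_b, with a nonlocal kernel w₅. We put these
powers in the form of a sum on X of quantities defined in X only. To each b ∈ T_η and each collection of bonds b₁, …, b_m ∈ T^{(k)}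
we associate in some arbitrary manner a set X (a connected union of r(e_k)-cubes containing them). Then we put (w₅A′)^m_b =
Σ_X w_{b,m}(X), (5.7.5)"*.  p. 290: *"We may use (5.7.5) to analyze the interaction terms generated in the expansion with respect
to Ã̃ = θ_kH_{k,loc}A^{(k)} + w₅A′. Treating for the moment only the high order terms, we obtain an expansion for F_{1,j} in (5.6.7):"*
— the two displays quoted in the title — *"(Here |X|⁻ is defined as max{0, |X| − 1}, and Ã̃ has been rescaled to the ζ = L^{−j}
lattice.) In a similar fashion we can write"* the `F_{2,j}` display.  (5.6.7) p. 287: *"ũ_{k+1}ũ = ũ_{k+1}(1 + Σ_{n=1}^∞ (ie_jζÃ)ⁿ/n!)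
= ũ_{k+1}(1 + F_{1,j}(Ã))"*; p. 289: *"all fields are logarithmically bounded"*.

## The typing (model level, READING declared)

At a fixed bond `b` (resp. a fixed pair `(y,x)`, contour `Γ^{(j)}_{y,x}`) the rescaled field is `Ã̃_b = a_loc + Σ_{b′} w(b′)A′(b′)`
with the LOCAL part `a_loc = (θ_kH_{k,loc}A^{(k)})_b` and the row `w = w₅(b,·)` of the nonlocal kernel (`LocDatum`: `aloc`, `wr`,
`A'`, and the association `assoc m : (Fin m → bonds) → polymers` of (5.7.5), one for every `m`; the empty collection `m = 0` is
associated to the cube of `b`).  The powers are expanded BINOMIALLY, `Ã̃_bⁿ = Σ_m C(n,m)a_loc^{n−m}(w₅A′)_b^m`, and each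
`(w₅A′)_b^m = Σ_X w_{b,m}(X)` by (5.7.5) (`wloc` = the row form of r16's `wbm`, `wbm_eq_wloc`), giving the localized powers
`powLoc n X` with `Σ_X powLoc n X = Ã̃_bⁿ` (`sum_powLoc`); the localized HIGH-ORDER part is
`locRem X = Σ_{n ≥ n̄+1} (ie_jζ)ⁿ/n!·powLoc n X` and **`F1loc X = ζ^{−1}·locRem X`** is `F_{1,j,b}(X)`.  Polymers: r16's
`PolymerSys` (`|X|`, `|X|⁻ = cardMinus`); the `X`-sums run over any finite set `Xs` containing the range of the association
(finite volume).

## What is kernel-checked here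

* `pow_row_eq_sum_wloc` ((5.7.5) in row form), `sum_powLoc` (`Σ_X powLoc n X = Ã̃_bⁿ`), `summable_locRem_term`,
  **`sum_locRem_eq_remF1`** (`Σ_X locRem X =` p02's `remF1 n̄ (ie_jζÃ̃_b)`, exchange of the exponential tail with the finite
  `X`-sum), **`f1_display`** — THE FIRST DISPLAY with its `Σ_X`: `ζ^{−1}F₁(ie_jζÃ̃_b) = Σ_{n=1}^{n̄} ζ^{−1}(ie_jζÃ̃_b)ⁿ/n! +
  Σ_X F_{1,j,b}(X)`.
* THE BOUNDS from the two printed inputs — (5.7.6) in the shape p36's `ineq576_Zd` delivers it (`|w_{b,m}(X)| ≤ M^m e^{−κ|X|}` for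
  every `m ≥ 1`, `M = 1` printed) and *"fields logarithmically bounded"* `|a_loc| ≤ p`: `abs_powLoc_le` (`|powLoc n X| ≤
  (p+M)ⁿe^{−κ|X|⁻}`; the `|X|⁻` instead of `|X|` is exactly the purely local `m = 0` term, which sits on the single cube of `b`),
  `tsum_pow_div_factorial_tail_le` (tail of the exponential series), **`norm_locRem_le`**, **`norm_F1loc_le`** (`‖F_{1,j,b}(X)‖ ≤
  ζ^{n̄}(e_j(p+M))^{n̄+1}e^{e_jζ(p+M)}/(n̄+1)!·e^{−κ|X|⁻}`, every constant explicit), and the PRINTED SHAPE **`norm_F1loc_le_printed`**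
  (`≤ e_j^{n̄+1−α}e^{−cr(e_k)|X|⁻}`) under the displayed field-regime hypothesis `ζ^{n̄}(p+1)^{n̄+1}e^{e_jζ(p+1)}/(n̄+1)! ≤ e_j^{−α}`
  (the print's absorption of the powers of `p(e_k)` into `e_j^{−α}`; generic-constant reading as in G-C2-p36-03).  The `F_{2,j}`
  display and the `ℤ^d` model instance ((5.7.6) discharged by p36's `ineq576_Zd`) are file 1b `BIJ88F2Localized290`.

HONEST SCOPE.  Model level: `Ã̃_b`, `w₅`, `A′`, the association and the transporters `u_{k+1}(Γ)` are INPUTS in the displayed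
shapes; the identification of `a_loc` with `(θ_kH_{k,loc}A^{(k)})_b` and of `p` with `p(e_k)` is not derived; (5.7.7)–(5.7.9)
(`V_j`, `W^{(j)}`) are NOT here (files 2, 3).  Definitions with bodies (`wloc`, `LocDatum` + its fields/`nonloc`/`total`/
`radius`/`powLoc`/`locRem`/`F1loc`) + theorems; no `Prop` facts; axioms standard.
-/

noncomputable section

open scoped BigOperators
open Complex Finset

namespace Literature.MathematicalPhysics.QuantumFieldTheory.BalabanImbrieJaffe1984to88.BIJ88F1Localized290

open BIJ88Sect5Statements (F1)
open BIJ88Sect5StatementsPart2 (PolymerSys Ineq576)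
open BIJ88Sect5StatementsPart4 (wbm)
open BIJ88F1Taylor290 (remF1 F1_zeta_split remF1_eq_exp_sub)

/-! ## §1 (5.7.5) in row form: the localized powers `w_{b,m}(X)` of a kernel row -/

section Row

variable {β : Type*} [Fintype β] {Poly : Type*} [DecidableEq Poly]

/-- **(5.7.5) in row form**: for a kernel ROW `w = w₅(b,·)` (or `Σ_{b∈Γ} w₅(b,·)` for a contour), `w_m(X) = Σ_{(b₁…b_m) associated
to X} Π_l w(b_l)A′(b_l)` — r16's `BIJ88Sect5StatementsPart4.wbm` with the bond `b` absorbed into the row (`wbm_eq_wloc`).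
[cite: BalabanImbrieJaffe1988, (5.7.5) p.289] -/
def wloc (wr A' : β → ℝ) (m : ℕ) (assoc : (Fin m → β) → Poly) (X : Poly) : ℝ :=
  ∑ t ∈ (univ : Finset (Fin m → β)).filter (fun t => assoc t = X), ∏ l, wr (t l) * A' (t l)

/-- r16's `w_{b,m}(X)` of (5.7.5) IS `wloc` of the row `w₅(b,·)` (definitional). [cite: BalabanImbrieJaffe1988, (5.7.5) p.289] -/
theorem wbm_eq_wloc (w : β → β → ℝ) (A' : β → ℝ) (b : β) (m : ℕ) (assoc : (Fin m → β) → Poly) (X : Poly) :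
    wbm w A' b m assoc X = wloc (w b) A' m assoc X := rfl

/-- multinomial expansion of the `m`-th power of a row: `(Σ_{b′} w(b′)A′(b′))^m = Σ_{(b₁,…,b_m)} Π_l w(b_l)A′(b_l)`.
[cite: BalabanImbrieJaffe1988, (5.7.5) p.289] -/
theorem pow_row_eq_sum_tuples (wr A' : β → ℝ) (m : ℕ) :
    (∑ b', wr b' * A' b') ^ m = ∑ t : Fin m → β, ∏ l, wr (t l) * A' (t l) := by
  rw [← Fintype.prod_sum fun (_ : Fin m) (b' : β) => wr b' * A' b']
  simp

/-- **(5.7.5)** `(w₅A′)^m_b = Σ_X w_{b,m}(X)`, the `X`-sum over any finite set of polymers containing the range of the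
association (fibrewise regrouping). [cite: BalabanImbrieJaffe1988, (5.7.5) p.289] -/
theorem pow_row_eq_sum_wloc (wr A' : β → ℝ) (m : ℕ) (assoc : (Fin m → β) → Poly) (Xs : Finset Poly)
    (hXs : ∀ t, assoc t ∈ Xs) : (∑ b', wr b' * A' b') ^ m = ∑ X ∈ Xs, wloc wr A' m assoc X := by
  rw [pow_row_eq_sum_tuples]
  unfold wloc
  exact (Finset.sum_fiberwise_of_maps_to (fun t _ => hXs t) _).symm

/-- triangle inequality summed over ALL tuples: `|w_m(X)| ≤ (Σ_{b′} |w(b′)||A′(b′)|)^m`. [cite: BalabanImbrieJaffe1988, (5.7.6) p.290] -/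
theorem abs_wloc_le_pow (wr A' : β → ℝ) (m : ℕ) (assoc : (Fin m → β) → Poly) (X : Poly) :
    |wloc wr A' m assoc X| ≤ (∑ b', |wr b'| * |A' b'|) ^ m := by
  unfold wloc
  calc |∑ t ∈ (univ : Finset (Fin m → β)).filter (fun t => assoc t = X), ∏ l, wr (t l) * A' (t l)|
      ≤ ∑ t ∈ (univ : Finset (Fin m → β)).filter (fun t => assoc t = X), |∏ l, wr (t l) * A' (t l)| :=
        Finset.abs_sum_le_sum_abs _ _
    _ ≤ ∑ t : Fin m → β, |∏ l, wr (t l) * A' (t l)| :=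
        Finset.sum_le_sum_of_subset_of_nonneg (Finset.filter_subset _ _) fun _ _ _ => abs_nonneg _
    _ = ∑ t : Fin m → β, ∏ l, |wr (t l)| * |A' (t l)| := by
        refine Finset.sum_congr rfl fun t _ => ?_
        rw [Finset.abs_prod]
        exact Finset.prod_congr rfl fun l _ => abs_mul _ _
    _ = (∑ b', |wr b'| * |A' b'|) ^ m := (pow_row_eq_sum_tuples (fun b' => |wr b'|) (fun b' => |A' b'|) m).symm

/-- the EMPTY collection (`m = 0`): `|w_0(X)| ≤ 1` (at most the one empty tuple contributes, with the empty product `1`).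
[cite: BalabanImbrieJaffe1988, (5.7.5) p.289] -/
theorem abs_wloc_zero_le (wr A' : β → ℝ) (assoc : (Fin 0 → β) → Poly) (X : Poly) : |wloc wr A' 0 assoc X| ≤ 1 := by
  unfold wloc
  simp only [Finset.univ_eq_empty, Finset.prod_empty, Finset.sum_const, nsmul_eq_mul, mul_one]
  rw [Nat.abs_cast]
  have h : ((univ : Finset (Fin 0 → β)).filter (fun t => assoc t = X)).card ≤ 1 :=
    Finset.card_le_one.mpr fun a _ b _ => Subsingleton.elim a b
  exact_mod_cast h

/-- … and `w_0(X) = 0` unless `X` is the polymer associated to the empty collection (the cube of `b`).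
[cite: BalabanImbrieJaffe1988, (5.7.5) p.289] -/
theorem wloc_zero_eq_zero (wr A' : β → ℝ) (assoc : (Fin 0 → β) → Poly) (X : Poly) (h : ∀ t, assoc t ≠ X) :
    wloc wr A' 0 assoc X = 0 := by
  unfold wloc
  exact Finset.sum_eq_zero fun t ht => absurd (Finset.mem_filter.mp ht).2 (h t)

end Row

/-! ## §2 The localized powers of `Ã̃_b = a_loc + (w₅A′)_b` -/

/-- The data of the expansion at ONE bond `b` (resp. one pair `(y,x)`): the LOCAL part `a_loc = (θ_kH_{k,loc}A^{(k)})_b` of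
`Ã̃_b`, the row `wr = w₅(b,·)` of the nonlocal kernel, the field `A′`, and the association of (5.7.5) for every number `m` of
bonds (*"To each b ∈ T_η and each collection of bonds b₁, …, b_m ∈ T^{(k)} we associate in some arbitrary manner a set X"*).
[cite: BalabanImbrieJaffe1988, (5.7.5) p.289] -/
structure LocDatum (β Poly : Type*) where
  /-- the local part `(θ_kH_{k,loc}A^{(k)})_b` of `Ã̃_b` -/
  aloc : ℝ
  /-- the row `w₅(b,·)` of the nonlocal kernel -/
  wr : β → ℝ
  /-- the field `A′` -/
  A' : β → ℝ
  /-- the association map of (5.7.5), for each `m` -/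
  assoc : (m : ℕ) → (Fin m → β) → Poly

namespace LocDatum

variable {β : Type*} [Fintype β] {Poly : Type*} [DecidableEq Poly] (D : LocDatum β Poly)

/-- the nonlocal part `(w₅A′)_b = Σ_{b′} w₅(b,b′)A′(b′)` of `Ã̃_b`. [cite: BalabanImbrieJaffe1988, (5.7.1) p.289] -/
def nonloc : ℝ := ∑ b', D.wr b' * D.A' b'

/-- `Ã̃_b = (θ_kH_{k,loc}A^{(k)})_b + (w₅A′)_b` ((5.7.1): `Ã̃ = θ_kH_{k,loc}A^{(k)} + w₅A′`). [cite: BalabanImbrieJaffe1988, (5.7.1) p.289] -/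
def total : ℝ := D.aloc + D.nonloc

/-- the absolute size `|a_loc| + Σ_{b′} |w₅(b,b′)||A′(b′)|` controlling every localized power (convergence of the series).
[cite: BalabanImbrieJaffe1988, (5.7.6) p.290] -/
def radius : ℝ := |D.aloc| + ∑ b', |D.wr b'| * |D.A' b'|

omit [Fintype β] [DecidableEq Poly] in
/-- `0 ≤ radius`. [cite: BalabanImbrieJaffe1988, (5.7.6) p.290] -/
theorem radius_nonneg [Fintype β] : 0 ≤ D.radius :=
  add_nonneg (abs_nonneg _) (Finset.sum_nonneg fun _ _ => mul_nonneg (abs_nonneg _) (abs_nonneg _))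

/-- **the localized `n`-th power**: `powLoc n X = Σ_{m=0}^{n} C(n,m)·a_loc^{n−m}·w_{b,m}(X)` — the part of `Ã̃_bⁿ =
(a_loc + (w₅A′)_b)ⁿ` assigned to the region `X` after the binomial expansion and (5.7.5).
[cite: BalabanImbrieJaffe1988, (5.7.5) p.289, (5.7.7) p.290] -/
def powLoc (n : ℕ) (X : Poly) : ℝ :=
  ∑ m ∈ range (n + 1), (n.choose m : ℝ) * D.aloc ^ (n - m) * wloc D.wr D.A' m (D.assoc m) X

/-- **`Σ_X powLoc n X = Ã̃_bⁿ`** (binomial theorem + (5.7.5)), the `X`-sum over any finite set of polymers containing the range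
of the association. [cite: BalabanImbrieJaffe1988, (5.7.5) p.289, (5.7.7) p.290] -/
theorem sum_powLoc (Xs : Finset Poly) (hXs : ∀ m t, D.assoc m t ∈ Xs) (n : ℕ) :
    ∑ X ∈ Xs, D.powLoc n X = D.total ^ n := by
  unfold powLoc total nonloc
  rw [Finset.sum_comm, add_comm D.aloc, add_pow]
  refine Finset.sum_congr rfl fun m _ => ?_
  rw [← Finset.mul_sum, ← pow_row_eq_sum_wloc D.wr D.A' m (D.assoc m) Xs (hXs m)]
  ring

/-- a priori size: `|powLoc n X| ≤ radiusⁿ`. [cite: BalabanImbrieJaffe1988, (5.7.6) p.290] -/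
theorem abs_powLoc_le_radius_pow (n : ℕ) (X : Poly) : |D.powLoc n X| ≤ D.radius ^ n := by
  unfold powLoc radius
  calc |∑ m ∈ range (n + 1), (n.choose m : ℝ) * D.aloc ^ (n - m) * wloc D.wr D.A' m (D.assoc m) X|
      ≤ ∑ m ∈ range (n + 1), |(n.choose m : ℝ) * D.aloc ^ (n - m) * wloc D.wr D.A' m (D.assoc m) X| :=
        Finset.abs_sum_le_sum_abs _ _
    _ ≤ ∑ m ∈ range (n + 1), (∑ b', |D.wr b'| * |D.A' b'|) ^ m * |D.aloc| ^ (n - m) * (n.choose m : ℝ) := by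
        refine Finset.sum_le_sum fun m _ => ?_
        rw [abs_mul, abs_mul, Nat.abs_cast, abs_pow]
        calc (n.choose m : ℝ) * |D.aloc| ^ (n - m) * |wloc D.wr D.A' m (D.assoc m) X|
            ≤ (n.choose m : ℝ) * |D.aloc| ^ (n - m) * (∑ b', |D.wr b'| * |D.A' b'|) ^ m :=
              mul_le_mul_of_nonneg_left (abs_wloc_le_pow _ _ _ _ _) (by positivity)
          _ = _ := by ring
    _ = (∑ b', |D.wr b'| * |D.A' b'| + |D.aloc|) ^ n := (add_pow _ _ _).symm
    _ = (|D.aloc| + ∑ b', |D.wr b'| * |D.A' b'|) ^ n := by rw [add_comm]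

/-- **THE LOCALIZED POWERS ARE SMALL AND DECAY**: from (5.7.6) in the shape `|w_{b,m}(X)| ≤ M^m e^{−κ|X|}` for every `m ≥ 1`
(`M = 1`, `κ = cr(e_k)` printed; p36's `ineq576_Zd`), the field bound `|a_loc| ≤ p` (*"all fields are logarithmically bounded"*)
and the empty collection sitting on ONE cube: `|powLoc n X| ≤ (p+M)ⁿ e^{−κ|X|⁻}` — the purely local `m = 0` term has no decay,
whence `|X|⁻ = max{0,|X|−1}` in place of `|X|`. [cite: BalabanImbrieJaffe1988, (5.7.7) p.290] -/
theorem abs_powLoc_le (P : PolymerSys) [DecidableEq P.Poly] (D : LocDatum β P.Poly) {p M κ : ℝ} (hp : |D.aloc| ≤ p)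
    (hM : 0 ≤ M) (hκ : 0 ≤ κ)
    (h576 : ∀ m, 1 ≤ m → ∀ X, |wloc D.wr D.A' m (D.assoc m) X| ≤ M ^ m * Real.exp (-κ * P.card X))
    (h0 : ∀ t : Fin 0 → β, P.card (D.assoc 0 t) ≤ 1) (n : ℕ) (X : P.Poly) :
    |D.powLoc n X| ≤ (p + M) ^ n * Real.exp (-κ * P.cardMinus X) := by
  have hp0 : 0 ≤ p := (abs_nonneg _).trans hp
  -- every term is bounded by `C(n,m) p^{n-m} M^m e^{-κ|X|⁻}`
  have hterm : ∀ m ∈ range (n + 1),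
      |(n.choose m : ℝ) * D.aloc ^ (n - m) * wloc D.wr D.A' m (D.assoc m) X| ≤
        M ^ m * p ^ (n - m) * (n.choose m : ℝ) * Real.exp (-κ * P.cardMinus X) := by
    intro m _
    rw [abs_mul, abs_mul, Nat.abs_cast, abs_pow]
    have hal : |D.aloc| ^ (n - m) ≤ p ^ (n - m) := pow_le_pow_left₀ (abs_nonneg _) hp _
    rcases Nat.eq_zero_or_pos m with hm | hm
    · subst hm
      by_cases hX : ∃ t : Fin 0 → β, D.assoc 0 t = X
      · obtain ⟨t, ht⟩ := hX
        have hcm : P.cardMinus X = 0 := by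
          have := h0 t
          rw [ht] at this
          unfold PolymerSys.cardMinus
          omega
        rw [hcm, Nat.cast_zero, mul_zero, Real.exp_zero, mul_one, pow_zero, one_mul]
        calc (n.choose 0 : ℝ) * |D.aloc| ^ (n - 0) * |wloc D.wr D.A' 0 (D.assoc 0) X|
            ≤ (n.choose 0 : ℝ) * p ^ (n - 0) * 1 :=
              mul_le_mul (mul_le_mul_of_nonneg_left hal (by positivity)) (abs_wloc_zero_le _ _ _ _) (abs_nonneg _)
                (by positivity)
          _ = p ^ (n - 0) * (n.choose 0 : ℝ) := by ring
      · push Not at hX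
        rw [wloc_zero_eq_zero _ _ _ _ hX, abs_zero, mul_zero]
        positivity
    · calc (n.choose m : ℝ) * |D.aloc| ^ (n - m) * |wloc D.wr D.A' m (D.assoc m) X|
          ≤ (n.choose m : ℝ) * p ^ (n - m) * (M ^ m * Real.exp (-κ * P.card X)) :=
            mul_le_mul (mul_le_mul_of_nonneg_left hal (by positivity)) (h576 m hm X) (abs_nonneg _) (by positivity)
        _ ≤ (n.choose m : ℝ) * p ^ (n - m) * (M ^ m * Real.exp (-κ * P.cardMinus X)) :=
            mul_le_mul_of_nonneg_left (mul_le_mul_of_nonneg_left (P.exp_card_le_exp_cardMinus hκ X) (pow_nonneg hM _))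
              (by positivity)
        _ = _ := by ring
  calc |D.powLoc n X| ≤ ∑ m ∈ range (n + 1), |(n.choose m : ℝ) * D.aloc ^ (n - m) * wloc D.wr D.A' m (D.assoc m) X| :=
        Finset.abs_sum_le_sum_abs _ _
    _ ≤ ∑ m ∈ range (n + 1), M ^ m * p ^ (n - m) * (n.choose m : ℝ) * Real.exp (-κ * P.cardMinus X) :=
        Finset.sum_le_sum hterm
    _ = (M + p) ^ n * Real.exp (-κ * P.cardMinus X) := by rw [add_pow, Finset.sum_mul]
    _ = (p + M) ^ n * Real.exp (-κ * P.cardMinus X) := by rw [add_comm M p]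

/-! ## §3 The localized high-order part `F_{1,j,b}(X)` and the first display -/

/-- the localized HIGH-ORDER part of the exponential series at `b`: `locRem X = Σ_{n ≥ n̄+1} (ie_jζ)ⁿ/n!·powLoc n X` (index
`n = i + (n̄+1)`). [cite: BalabanImbrieJaffe1988, (5.7.7) p.290] -/
def locRem (ej ζ : ℝ) (nbar : ℕ) (X : Poly) : ℂ :=
  ∑' i : ℕ, (I * (ej * ζ : ℝ)) ^ (i + (nbar + 1)) / ((i + (nbar + 1)).factorial : ℂ) * (D.powLoc (i + (nbar + 1)) X : ℂ)

/-- **`F_{1,j,b}(X) := ζ^{−1}·Σ_{n ≥ n̄+1} (ie_jζ)ⁿ/n!·powLoc n X`** — the quantity the print calls `F_{1,j,b}(X)`.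
[cite: BalabanImbrieJaffe1988, (5.7.7) p.290] -/
def F1loc (ej ζ : ℝ) (nbar : ℕ) (X : Poly) : ℂ := (ζ : ℂ)⁻¹ * D.locRem ej ζ nbar X

/-- norm of the coefficient `(ie_jζ)ⁿ/n!`: `|e_jζ|ⁿ/n!`. [cite: BalabanImbrieJaffe1988, (5.7.7) p.290] -/
theorem norm_coeff (ej ζ : ℝ) (n : ℕ) :
    ‖(I * (ej * ζ : ℝ)) ^ n / (n.factorial : ℂ)‖ = |ej * ζ| ^ n / n.factorial := by
  rw [norm_div, norm_pow, norm_mul, Complex.norm_I, one_mul, Complex.norm_real, Real.norm_eq_abs,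
    Complex.norm_natCast]

/-- termwise majorant of the series of `locRem`: `‖(ie_jζ)ⁿ/n!·powLoc n X‖ ≤ (|e_jζ|·radius)ⁿ/n!`.
[cite: BalabanImbrieJaffe1988, (5.7.7) p.290] -/
theorem norm_locRem_term_le (ej ζ : ℝ) (nbar : ℕ) (X : Poly) (i : ℕ) :
    ‖(I * (ej * ζ : ℝ)) ^ (i + (nbar + 1)) / ((i + (nbar + 1)).factorial : ℂ) * (D.powLoc (i + (nbar + 1)) X : ℂ)‖ ≤
      (|ej * ζ| * D.radius) ^ (i + (nbar + 1)) / (i + (nbar + 1)).factorial := by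
  rw [norm_mul, norm_coeff, Complex.norm_real, Real.norm_eq_abs, mul_pow, div_mul_eq_mul_div]
  gcongr
  exact D.abs_powLoc_le_radius_pow _ _

/-- the series defining `locRem X` converges absolutely (majorant: the exponential series of `|e_jζ|·radius`).
[cite: BalabanImbrieJaffe1988, (5.7.7) p.290] -/
theorem summable_locRem_term (ej ζ : ℝ) (nbar : ℕ) (X : Poly) :
    Summable fun i : ℕ =>
      (I * (ej * ζ : ℝ)) ^ (i + (nbar + 1)) / ((i + (nbar + 1)).factorial : ℂ) * (D.powLoc (i + (nbar + 1)) X : ℂ) := by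
  refine Summable.of_norm_bounded ?_ (D.norm_locRem_term_le ej ζ nbar X)
  exact (summable_nat_add_iff (nbar + 1)).mpr (Real.summable_pow_div_factorial (|ej * ζ| * D.radius))

/-- the exponential TAIL: p02's `remF1 n̄ w = e^{w} − Σ_{m ≤ n̄} w^m/m!` is the sum of the terms of order `≥ n̄+1`.
[cite: BalabanImbrieJaffe1988, (5.7.7) p.290] -/
theorem hasSum_remF1 (nbar : ℕ) (w : ℂ) :
    HasSum (fun i : ℕ => w ^ (i + (nbar + 1)) / ((i + (nbar + 1)).factorial : ℂ)) (remF1 nbar w) := by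
  have h := NormedSpace.expSeries_div_hasSum_exp w
  rw [← congr_fun Complex.exp_eq_exp_ℂ w] at h
  rw [remF1_eq_exp_sub]
  exact (hasSum_nat_add_iff' (nbar + 1)).mpr h

/-- **`Σ_X locRem X = remF1 n̄ (ie_jζÃ̃_b)`**: summing the localized high-order parts over the regions gives back p02's
high-order part of `F₁` (exchange of the finite `X`-sum with the series, `sum_powLoc`, the exponential tail).
[cite: BalabanImbrieJaffe1988, (5.7.7) p.290] -/
theorem sum_locRem_eq_remF1 (Xs : Finset Poly) (hXs : ∀ m t, D.assoc m t ∈ Xs) (ej ζ : ℝ) (nbar : ℕ) :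
    ∑ X ∈ Xs, D.locRem ej ζ nbar X = remF1 nbar (I * (ej * ζ * D.total : ℝ)) := by
  unfold locRem
  rw [← Summable.tsum_finsetSum fun X _ => D.summable_locRem_term ej ζ nbar X, ← (hasSum_remF1 nbar _).tsum_eq]
  refine tsum_congr fun i => ?_
  rw [← Finset.mul_sum, ← Complex.ofReal_sum, D.sum_powLoc Xs hXs]
  push_cast
  ring

/-- **p. 290, THE FIRST DISPLAY WITH ITS SUM OVER REGIONS**, verbatim: *"F_{1,j}(Ã̃^ζ_b) = Σ_{n=1}^{n̄} ζ^{−1}(ie_jζÃ̃^ζ_b)ⁿ/n! +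
Σ_X F_{1,j,b}(X)"* — PROVED for `F_{1,j} = ζ^{−1}F₁(ie_jζ·)` (r16's `F1`, p02's `F1_zeta_split`) and the constructed `F1loc`, the
`X`-sum over any finite set of polymers containing the range of the association. [cite: BalabanImbrieJaffe1988, (5.7.7) p.290] -/
theorem f1_display (Xs : Finset Poly) (hXs : ∀ m t, D.assoc m t ∈ Xs) (ej ζ : ℝ) (nbar : ℕ) :
    (ζ : ℂ)⁻¹ * F1 (I * (ej * ζ * D.total : ℝ)) =
      (∑ n ∈ range nbar, (ζ : ℂ)⁻¹ * (I * (ej * ζ * D.total : ℝ)) ^ (n + 1) / (n + 1).factorial) +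
        ∑ X ∈ Xs, D.F1loc ej ζ nbar X := by
  rw [F1_zeta_split]
  unfold F1loc
  rw [← Finset.mul_sum, D.sum_locRem_eq_remF1 Xs hXs]

/-! ## §4 The remainder bounds -/

/-- the TAIL OF THE EXPONENTIAL SERIES: `Σ_{n ≥ N} rⁿ/n! ≤ r^N/N!·e^{r}` for `r ≥ 0` (`N!·i! ≤ (N+i)!`).
[cite: BalabanImbrieJaffe1988, (5.7.7) p.290] -/
theorem tsum_pow_div_factorial_tail_le {r : ℝ} (hr : 0 ≤ r) (N : ℕ) :
    ∑' i : ℕ, r ^ (i + N) / ((i + N).factorial : ℝ) ≤ r ^ N / (N.factorial : ℝ) * Real.exp r := by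
  have hexp : Real.exp r = ∑' i : ℕ, r ^ i / (i.factorial : ℝ) := by
    rw [congr_fun Real.exp_eq_exp_ℝ r, congr_fun NormedSpace.exp_eq_tsum_div r]
  rw [hexp, ← tsum_mul_left]
  refine Summable.tsum_le_tsum (fun i => ?_)
    ((summable_nat_add_iff N).mpr (Real.summable_pow_div_factorial r))
    ((Real.summable_pow_div_factorial r).mul_left _)
  have hfac : ((N.factorial * i.factorial : ℕ) : ℝ) ≤ ((i + N).factorial : ℝ) := by
    exact_mod_cast Nat.le_of_dvd (Nat.factorial_pos _) (by
      rw [mul_comm, add_comm]; exact Nat.factorial_mul_factorial_dvd_factorial_add i N |>.trans (by rw [add_comm]))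
  rw [div_mul_div_comm, ← pow_add, add_comm N i]
  push_cast at hfac
  exact div_le_div_of_nonneg_left (pow_nonneg hr _) (by positivity) hfac

/-- **THE BOUND ON THE LOCALIZED HIGH-ORDER PART**: with `|powLoc n X| ≤ Qⁿ·E` for all `n` (`Q, E ≥ 0`),
`‖locRem X‖ ≤ (|e_jζ|Q)^{n̄+1}/(n̄+1)!·e^{|e_jζ|Q}·E`. [cite: BalabanImbrieJaffe1988, (5.7.7) p.290] -/
theorem norm_locRem_le_of_powLoc {ej ζ Q E : ℝ} (hQ : 0 ≤ Q) (hE : 0 ≤ E) {X : Poly}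
    (hpow : ∀ n, |D.powLoc n X| ≤ Q ^ n * E) (nbar : ℕ) :
    ‖D.locRem ej ζ nbar X‖ ≤
      (|ej * ζ| * Q) ^ (nbar + 1) / ((nbar + 1).factorial : ℝ) * Real.exp (|ej * ζ| * Q) * E := by
  have hr : 0 ≤ |ej * ζ| * Q := mul_nonneg (abs_nonneg _) hQ
  -- termwise majorant
  have hmaj : ∀ i : ℕ,
      ‖(I * (ej * ζ : ℝ)) ^ (i + (nbar + 1)) / ((i + (nbar + 1)).factorial : ℂ) * (D.powLoc (i + (nbar + 1)) X : ℂ)‖ ≤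
        (|ej * ζ| * Q) ^ (i + (nbar + 1)) / ((i + (nbar + 1)).factorial : ℝ) * E := by
    intro i
    rw [norm_mul, norm_coeff, Complex.norm_real, Real.norm_eq_abs, mul_pow, div_mul_eq_mul_div, div_mul_eq_mul_div,
      mul_assoc]
    gcongr
    exact hpow _
  have hsum : Summable fun i : ℕ => (|ej * ζ| * Q) ^ (i + (nbar + 1)) / ((i + (nbar + 1)).factorial : ℝ) * E :=
    ((summable_nat_add_iff (nbar + 1)).mpr (Real.summable_pow_div_factorial (|ej * ζ| * Q))).mul_right E
  unfold locRem
  calc ‖∑' i : ℕ, (I * (ej * ζ : ℝ)) ^ (i + (nbar + 1)) / ((i + (nbar + 1)).factorial : ℂ) *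
          (D.powLoc (i + (nbar + 1)) X : ℂ)‖
      ≤ ∑' i : ℕ, ‖(I * (ej * ζ : ℝ)) ^ (i + (nbar + 1)) / ((i + (nbar + 1)).factorial : ℂ) *
          (D.powLoc (i + (nbar + 1)) X : ℂ)‖ :=
        norm_tsum_le_tsum_norm (Summable.of_nonneg_of_le (fun _ => norm_nonneg _) hmaj hsum)
    _ ≤ ∑' i : ℕ, (|ej * ζ| * Q) ^ (i + (nbar + 1)) / ((i + (nbar + 1)).factorial : ℝ) * E :=
        Summable.tsum_le_tsum hmaj (Summable.of_nonneg_of_le (fun _ => norm_nonneg _) hmaj hsum) hsum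
    _ = (∑' i : ℕ, (|ej * ζ| * Q) ^ (i + (nbar + 1)) / ((i + (nbar + 1)).factorial : ℝ)) * E := tsum_mul_right
    _ ≤ (|ej * ζ| * Q) ^ (nbar + 1) / ((nbar + 1).factorial : ℝ) * Real.exp (|ej * ζ| * Q) * E :=
        mul_le_mul_of_nonneg_right (tsum_pow_div_factorial_tail_le hr _) hE

/-- **`‖locRem X‖ ≤ (|e_jζ|(p+M))^{n̄+1}/(n̄+1)!·e^{|e_jζ|(p+M)}·e^{−κ|X|⁻}`** from (5.7.6)-shape decay, the field bound and the
single home cube (`abs_powLoc_le`). [cite: BalabanImbrieJaffe1988, (5.7.7) p.290] -/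
theorem norm_locRem_le (P : PolymerSys) [DecidableEq P.Poly] (D : LocDatum β P.Poly) {p M κ : ℝ} (hp : |D.aloc| ≤ p)
    (hM : 0 ≤ M) (hκ : 0 ≤ κ)
    (h576 : ∀ m, 1 ≤ m → ∀ X, |wloc D.wr D.A' m (D.assoc m) X| ≤ M ^ m * Real.exp (-κ * P.card X))
    (h0 : ∀ t : Fin 0 → β, P.card (D.assoc 0 t) ≤ 1) (ej ζ : ℝ) (nbar : ℕ) (X : P.Poly) :
    ‖D.locRem ej ζ nbar X‖ ≤ (|ej * ζ| * (p + M)) ^ (nbar + 1) / ((nbar + 1).factorial : ℝ) *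
      Real.exp (|ej * ζ| * (p + M)) * Real.exp (-κ * P.cardMinus X) :=
  D.norm_locRem_le_of_powLoc (add_nonneg ((abs_nonneg _).trans hp) hM) (Real.exp_pos _).le
    (D.abs_powLoc_le P hp hM hκ h576 h0 · X) nbar

/-- **THE BOUND ON `F_{1,j,b}(X)`, constants explicit**: for `e_j ≥ 0`, `ζ > 0`,
`‖F_{1,j,b}(X)‖ ≤ ζ^{n̄}(e_j(p+M))^{n̄+1}/(n̄+1)!·e^{e_jζ(p+M)}·e^{−κ|X|⁻}`. [cite: BalabanImbrieJaffe1988, (5.7.7) p.290] -/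
theorem norm_F1loc_le (P : PolymerSys) [DecidableEq P.Poly] (D : LocDatum β P.Poly) {ej ζ p M κ : ℝ} (hej : 0 ≤ ej)
    (hζ : 0 < ζ) (hp : |D.aloc| ≤ p) (hM : 0 ≤ M) (hκ : 0 ≤ κ)
    (h576 : ∀ m, 1 ≤ m → ∀ X, |wloc D.wr D.A' m (D.assoc m) X| ≤ M ^ m * Real.exp (-κ * P.card X))
    (h0 : ∀ t : Fin 0 → β, P.card (D.assoc 0 t) ≤ 1) (nbar : ℕ) (X : P.Poly) :
    ‖D.F1loc ej ζ nbar X‖ ≤ ζ ^ nbar * (ej * (p + M)) ^ (nbar + 1) / ((nbar + 1).factorial : ℝ) *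
      Real.exp (ej * ζ * (p + M)) * Real.exp (-κ * P.cardMinus X) := by
  have h := D.norm_locRem_le P hp hM hκ h576 h0 ej ζ nbar X
  rw [abs_of_nonneg (mul_nonneg hej hζ.le)] at h
  unfold F1loc
  rw [norm_mul, norm_inv, Complex.norm_real, Real.norm_eq_abs, abs_of_pos hζ]
  calc ζ⁻¹ * ‖D.locRem ej ζ nbar X‖
      ≤ ζ⁻¹ * ((ej * ζ * (p + M)) ^ (nbar + 1) / ((nbar + 1).factorial : ℝ) * Real.exp (ej * ζ * (p + M)) *
          Real.exp (-κ * P.cardMinus X)) := mul_le_mul_of_nonneg_left h (inv_nonneg.mpr hζ.le)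
    _ = ζ ^ nbar * (ej * (p + M)) ^ (nbar + 1) / ((nbar + 1).factorial : ℝ) * Real.exp (ej * ζ * (p + M)) *
          Real.exp (-κ * P.cardMinus X) := by
        rw [show ej * ζ * (p + M) = (ej * (p + M)) * ζ by ring, mul_pow _ ζ, pow_succ ζ nbar]
        field_simp

/-- **p. 290, THE PRINTED REMAINDER BOUND** *"with |F_{1,j,b}(X)| ≦ e_j^{n̄+1−α}e^{−cr(e_k)|X|⁻}"*: from (5.7.6) (r16's `Ineq576`
shape for every `m ≥ 1`, as p36's `ineq576_Zd` proves it), the field bound `|a_loc| ≤ p`, the empty collection on one cube, and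
the displayed FIELD REGIME `ζ^{n̄}(p+1)^{n̄+1}e^{e_jζ(p+1)}/(n̄+1)! ≤ e_j^{−α}` (the powers of `p(e_k)` absorbed into `e_j^{−α}`).
[cite: BalabanImbrieJaffe1988, (5.7.7) p.290] -/
theorem norm_F1loc_le_printed (P : PolymerSys) [DecidableEq P.Poly] (D : LocDatum β P.Poly) {ej ζ p c rk α : ℝ}
    (hej : 0 < ej) (hζ : 0 < ζ) (hp : |D.aloc| ≤ p) (hc : 0 ≤ c * rk)
    (h576 : ∀ m, 1 ≤ m → Ineq576 P (wloc D.wr D.A' m (D.assoc m)) c rk)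
    (h0 : ∀ t : Fin 0 → β, P.card (D.assoc 0 t) ≤ 1) {nbar : ℕ}
    (hfield : ζ ^ nbar * (p + 1) ^ (nbar + 1) * Real.exp (ej * ζ * (p + 1)) / ((nbar + 1).factorial : ℝ) ≤ ej ^ (-α))
    (X : P.Poly) :
    ‖D.F1loc ej ζ nbar X‖ ≤ ej ^ ((nbar : ℝ) + 1 - α) * Real.exp (-(c * rk) * P.cardMinus X) := by
  have h576' : ∀ m, 1 ≤ m → ∀ X, |wloc D.wr D.A' m (D.assoc m) X| ≤ (1 : ℝ) ^ m * Real.exp (-(c * rk) * P.card X) :=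
    fun m hm X => by rw [one_pow, one_mul]; exact h576 m hm X
  have h := D.norm_F1loc_le P hej.le hζ hp zero_le_one hc h576' h0 nbar X
  have hrw : ej ^ ((nbar : ℝ) + 1 - α) = ej ^ (nbar + 1) * ej ^ (-α) := by
    rw [show (nbar : ℝ) + 1 - α = ((nbar + 1 : ℕ) : ℝ) + (-α) by push_cast; ring, Real.rpow_add hej,
      Real.rpow_natCast]
  rw [hrw]
  refine h.trans ?_
  have hE : 0 ≤ Real.exp (-(c * rk) * P.cardMinus X) := (Real.exp_pos _).le
  calc ζ ^ nbar * (ej * (p + 1)) ^ (nbar + 1) / ((nbar + 1).factorial : ℝ) * Real.exp (ej * ζ * (p + 1)) *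
          Real.exp (-(c * rk) * P.cardMinus X)
      = ej ^ (nbar + 1) * (ζ ^ nbar * (p + 1) ^ (nbar + 1) * Real.exp (ej * ζ * (p + 1)) / ((nbar + 1).factorial : ℝ)) *
          Real.exp (-(c * rk) * P.cardMinus X) := by rw [mul_pow]; ring
    _ ≤ ej ^ (nbar + 1) * ej ^ (-α) * Real.exp (-(c * rk) * P.cardMinus X) :=
        mul_le_mul_of_nonneg_right (mul_le_mul_of_nonneg_left hfield (pow_nonneg hej.le _)) hE

end LocDatum

end Literature.MathematicalPhysics.QuantumFieldTheory.BalabanImbrieJaffe1984to88.BIJ88F1Localized290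

end
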